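import Literature.AlgebraicGeometry.Resolution.BlowupStrictTransform
import Mathlib.RingTheory.Localization.AtPrime.Basic
import HarnessLib

/-!
# Absorption: `A[I/a] = B[IB/a]` when `A ⊆ B` and `I` is a `B`-ideal — blowing up a conductor-type ideal does not see the
# finite birational extension (Stacks 052Q functoriality; used for `Bl_I Spec 𝒪 ≅ Bl_I Spec B`, `𝒪 ⊂ B` finite birational)

Topic: `Literature/AlgebraicGeometry/Resolution`. For an INJECTIVE ring map `φ : A → B`, an ideal `I ⊆ A` which is a `B`-ideal
through `φ` (`I·B = I`: every `b · φ(x)`, `x ∈ I`, is again some `φ(y)`, `y ∈ I` — e.g. `A ⊂ B` an extension inside the total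
ring of fractions and `I` any `B`-ideal contained in `A`, such as the conductor) and `a ∈ I`, the map of affine blowup algebras
`ψ : A[I/a] → B[IB/φ a]` (`blowupAlgebraMap`, `BlowupStrictTransform.lean`; image models `A[I/a] ⊆ A[1/a]`, Stacks 052Q /
Görtz–Wedhorn (13.19)) is an ISOMORPHISM: injective because `A[1/a] → B[1/φ a]` is, surjective because `B ⊆ A[I/a]` there
(`b = φ(y)/φ(a)` with `y = «b·a» ∈ I`). Hence the blowing ups of `Spec A` and `Spec B` along `I` have the same charts, and every
local ring of `B[IB/φ a]` is a local ring of `A[I/a]` with the same contraction to `A`.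

* `awayMap_injective` — `A[1/a] → B[1/φ a]` is injective for `φ` injective;
* `blowupAlgebraMap_injective` — so is `ψ : A[I/a] → B[J/φ a]` (any `J ⊇ I·B`);
* `blowupAlgebraMap_surjective_of_absorb` — `ψ` is onto `B[IB/φ a]` when `a ∈ I` and `I·B = I`;
* `blowupAlgebraMap_bijective_of_absorb`, `exists_ringEquiv_of_absorb` — the isomorphism `A[I/a] ≃+* B[IB/φ a]` over `φ`;
* `exists_atPrime_ringEquiv_of_absorb` — primes and local rings correspond, compatibly with the contractions to `A`.

Everything is PROVED; no definitions, no named facts.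

## Sources

* The Stacks Project, Tag 052Q (affine blowup algebras and their functoriality), Tag 0804. [StacksProject]
* U. Görtz, T. Wedhorn, *Algebraic Geometry I*, 2nd ed. (2020), (13.19) p. 415. [GortzWedhorn2020]
-/

noncomputable section

open IsLocalization

namespace Literature.AlgebraicGeometry.Resolution

universe u

namespace BlowupAlgebraAbsorption

variable {A B : Type u} [CommRing A] [CommRing B] (φ : A →+* B) (I : Ideal A) (a : A)

/-- **`A[1/a] → B[1/φ a]` is injective when `φ` is**: `φ(x)/φ(a)ⁿ = 0` forces `φ(aᵉ x) = 0`, so `aᵉ x = 0`.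
[cite: StacksProject, Tag 052Q] -/
theorem awayMap_injective (hφ : Function.Injective φ) : Function.Injective (Localization.awayMap φ a) := by
  rw [injective_iff_map_eq_zero]
  intro z hz
  obtain ⟨x, u, rfl⟩ := IsLocalization.mk'_surjective (Submonoid.powers a) z
  rw [Localization.awayMap, IsLocalization.Away.map, IsLocalization.map_mk', IsLocalization.mk'_eq_zero_iff] at hz
  obtain ⟨⟨_, e, rfl⟩, he⟩ := hz
  rw [IsLocalization.mk'_eq_zero_iff]
  refine ⟨⟨a ^ e, e, rfl⟩, hφ ?_⟩
  rw [map_mul, map_zero, map_pow]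
  exact he

/-- **`ψ : A[I/a] → B[J/φ a]` is injective when `φ` is** (restriction of `A[1/a] → B[1/φ a]`). [cite: StacksProject, Tag 052Q] -/
theorem blowupAlgebraMap_injective (hφ : Function.Injective φ) (J : Ideal B) (hIJ : I.map φ ≤ J) :
    Function.Injective (blowupAlgebraMap φ I J a hIJ) := fun x y h =>
  Subtype.ext (awayMap_injective φ a hφ (by rw [← coe_blowupAlgebraMap φ I J a hIJ, ← coe_blowupAlgebraMap φ I J a hIJ, h]))

/-- **ABSORPTION: `ψ : A[I/a] → B[IB/φ a]` is surjective when `a ∈ I` and `I` is a `B`-ideal** (`I·B = I`: every `b·φ(x)`,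
`x ∈ I`, is `φ(y)` for some `y ∈ I`): `B ∋ b = φ(y)/φ(a)` with `φ(y) = b·φ(a)`, and `φ(x)/φ(a) = ψ(x/a)`.
[cite: StacksProject, Tag 052Q] -/
theorem blowupAlgebraMap_surjective_of_absorb (ha : a ∈ I) (hIB : ∀ (b : B) (x : A), x ∈ I → ∃ y ∈ I, φ y = b * φ x) :
    Function.Surjective (blowupAlgebraMap φ I (I.map φ) a le_rfl) := by
  -- `P z`: `z ∈ B[1/φ a]` is in the image of `ψ`
  suffices h : ∀ z : Localization.Away (φ a), z ∈ blowupAlgebra (I.map φ) (φ a) →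
      ∃ v : blowupAlgebra I a, (blowupAlgebraMap φ I (I.map φ) a le_rfl v : Localization.Away (φ a)) = z by
    intro x
    obtain ⟨v, hv⟩ := h x.1 x.2
    exact ⟨v, Subtype.ext hv⟩
  -- `B` lies in the image: `b = φ(y)/φ(a)`, `φ(y) = b φ(a)`, `y ∈ I`
  have hB : ∀ b : B, ∃ v : blowupAlgebra I a,
      (blowupAlgebraMap φ I (I.map φ) a le_rfl v : Localization.Away (φ a)) = algebraMap B (Localization.Away (φ a)) b := by
    intro b
    obtain ⟨y, hy, hφy⟩ := hIB b a ha
    refine ⟨⟨_, div_mem_blowupAlgebra I a hy⟩, ?_⟩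
    rw [coe_blowupAlgebraMap, Subtype.coe_mk, map_mul, awayMap_algebraMap, awayMap_invSelf, hφy, map_mul, mul_assoc,
      IsLocalization.Away.mul_invSelf, mul_one]
  intro z hz
  induction hz using Algebra.adjoin_induction with
  | mem z hz =>
    obtain ⟨w, hw, rfl⟩ := hz
    -- `w ∈ I·B = span (φ '' I)`
    rw [Ideal.map] at hw
    induction hw using Submodule.span_induction with
    | mem w hw =>
      obtain ⟨x, hx, rfl⟩ := hw
      refine ⟨⟨_, div_mem_blowupAlgebra I a hx⟩, ?_⟩
      rw [coe_blowupAlgebraMap, Subtype.coe_mk, map_mul, awayMap_algebraMap, awayMap_invSelf]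
    | zero => exact ⟨0, by rw [map_zero, ZeroMemClass.coe_zero, map_zero, zero_mul]⟩
    | add w₁ w₂ _ _ h₁ h₂ =>
      obtain ⟨v₁, hv₁⟩ := h₁
      obtain ⟨v₂, hv₂⟩ := h₂
      exact ⟨v₁ + v₂, by rw [map_add, Subalgebra.coe_add, hv₁, hv₂, map_add, add_mul]⟩
    | smul b w _ h =>
      obtain ⟨v, hv⟩ := h
      obtain ⟨v', hv'⟩ := hB b
      exact ⟨v' * v, by rw [map_mul, Subalgebra.coe_mul, hv, hv', smul_eq_mul, map_mul, mul_assoc]⟩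
  | algebraMap b => exact hB b
  | add z₁ z₂ _ _ h₁ h₂ =>
    obtain ⟨v₁, hv₁⟩ := h₁
    obtain ⟨v₂, hv₂⟩ := h₂
    exact ⟨v₁ + v₂, by rw [map_add, Subalgebra.coe_add, hv₁, hv₂]⟩
  | mul z₁ z₂ _ _ h₁ h₂ =>
    obtain ⟨v₁, hv₁⟩ := h₁
    obtain ⟨v₂, hv₂⟩ := h₂
    exact ⟨v₁ * v₂, by rw [map_mul, Subalgebra.coe_mul, hv₁, hv₂]⟩

/-- **ABSORPTION: `A[I/a] ≅ B[IB/φ a]`** for `φ` injective, `a ∈ I`, `I·B = I`. [cite: StacksProject, Tag 052Q] -/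
theorem blowupAlgebraMap_bijective_of_absorb (hφ : Function.Injective φ) (ha : a ∈ I)
    (hIB : ∀ (b : B) (x : A), x ∈ I → ∃ y ∈ I, φ y = b * φ x) :
    Function.Bijective (blowupAlgebraMap φ I (I.map φ) a le_rfl) :=
  ⟨blowupAlgebraMap_injective φ I a hφ _ le_rfl, blowupAlgebraMap_surjective_of_absorb φ I a ha hIB⟩

/-- The absorption isomorphism as a `RingEquiv` over `φ`: `e (x/1) = φ(x)/1`. [cite: StacksProject, Tag 052Q] -/
theorem exists_ringEquiv_of_absorb (hφ : Function.Injective φ) (ha : a ∈ I)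
    (hIB : ∀ (b : B) (x : A), x ∈ I → ∃ y ∈ I, φ y = b * φ x) :
    ∃ e : blowupAlgebra I a ≃+* blowupAlgebra (I.map φ) (φ a),
      (∀ v, e v = blowupAlgebraMap φ I (I.map φ) a le_rfl v) ∧
      ∀ x : A, e (algebraMap A (blowupAlgebra I a) x) = algebraMap B (blowupAlgebra (I.map φ) (φ a)) (φ x) :=
  ⟨RingEquiv.ofBijective _ (blowupAlgebraMap_bijective_of_absorb φ I a hφ ha hIB), fun _ => rfl,
    fun x => blowupAlgebraMap_algebraMap φ I (I.map φ) a le_rfl x⟩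

/-- **Local rings correspond under absorption**: for `φ : A → B` injective, `a ∈ I`, `I·B = I`, every prime `𝔔'` of `B[IB/φ a]`
contracts to a prime `𝔔` of `A[I/a]` with `A[I/a]_𝔔 ≅ B[IB/φ a]_𝔔'` and `𝔔 ∩ A = φ⁻¹(𝔔' ∩ B)` — the blowing ups of `Spec A` and
`Spec B` along `I` have the same local rings. [cite: StacksProject, Tag 0804] -/
theorem exists_atPrime_ringEquiv_of_absorb (hφ : Function.Injective φ) (ha : a ∈ I)
    (hIB : ∀ (b : B) (x : A), x ∈ I → ∃ y ∈ I, φ y = b * φ x)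
    (𝔔' : Ideal (blowupAlgebra (I.map φ) (φ a))) [𝔔'.IsPrime] :
    ∃ 𝔔 : PrimeSpectrum (blowupAlgebra I a),
      𝔔.asIdeal.comap (algebraMap A (blowupAlgebra I a)) = (𝔔'.comap (algebraMap B (blowupAlgebra (I.map φ) (φ a)))).comap φ ∧
      Nonempty (Localization.AtPrime 𝔔.asIdeal ≃+* Localization.AtPrime 𝔔') := by
  obtain ⟨e, he, healg⟩ := exists_ringEquiv_of_absorb φ I a hφ ha hIB
  refine ⟨⟨𝔔'.comap e.toRingHom, Ideal.comap_isPrime _ _⟩, ?_, ⟨?_⟩⟩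
  · ext x
    simp only [Ideal.mem_comap, RingEquiv.toRingHom_eq_coe, RingHom.coe_coe, healg]
  · -- both localizations of `A[I/a]` at `𝔔 = e⁻¹ 𝔔'`
    have hmap : (𝔔'.comap e.toRingHom).primeCompl.map e.toMonoidHom = 𝔔'.primeCompl := by
      ext y
      simp only [Submonoid.mem_map, Ideal.mem_primeCompl_iff, Ideal.mem_comap]
      constructor
      · rintro ⟨x, hx, rfl⟩
        exact hx
      · intro hy
        exact ⟨e.symm y, by simpa using hy, by simp⟩
    exact IsLocalization.ringEquivOfRingEquiv (Localization.AtPrime (𝔔'.comap e.toRingHom)) (Localization.AtPrime 𝔔')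
      e hmap

end BlowupAlgebraAbsorption

end Literature.AlgebraicGeometry.Resolution

end
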